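import Literature.NumberTheory.EllipticCurves.PadicSigmaIsogenyCriterionProofs
import Literature.NumberTheory.EllipticCurves.VeluLogDerivativeProofs
import HarnessLib

/-!
# Blakestad–Grant's Lemma 10 summed, in Kohel's polynomial form, and its transport to the formal
# group: `mazur_tate_sigma_existsUnique` from the kernel polynomial of the canonical `p`-isogeny

Trunk T-NT-EC (Literature/NumberTheory/EllipticCurves). Glue between the tree's two halves of
Blakestad–Grant's proof of the integrality of the Mazur–Tate sigma function (J. Number Theory 249
(2023), Thm. 1): the GEOMETRIC half (`VeluOddKernelProofs`, `VeluNormProofs`,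
`VeluKernelReductionProofs`: Vélu's isogeny `x₁ = U/P₂`, `P₂ = D²`, the quotient by the canonical
subgroup, its reduction to Frobenius, the formal isogeny `t_p = t·Φ·u`) speaks of POLYNOMIALS in
`x` and of sums over kernel points; the ANALYTIC half (`PadicSigmaIsogenyCriterionProofs`:
Prop. 13, Thm. 1 by Dwork's lemma) wants the Vélu–Lemma 10 identity
`x₁∘ψ = p·x - Σ' x(v) - D(D D(x)/D(x))` as an identity of POWER SERIES in the parameter `t`.
This file supplies both conversions:

* `WeierstrassCurve.veluLogOp W Q = 𝓛(Q) = 2Q·L(Q') - 4f·Q'²` (`L = zetaOp`, `f = rhsCubic`): the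
  numerator of `D(DQ(x)/Q(x))` (`Q(x)²·D² log Q(x) = 𝓛(Q)(x)`, since `Dx = 2y`, `Dy = f'(x)`);
  `veluLogOp_mul` (logarithmic), **`veluLogOp_X_sub_C` / `two_mul_X_mul_sq_sub_veluLogOp_X_sub_C`
  — Blakestad–Grant's Lemma 10 as a polynomial identity** (`(x - c)²(x∘τ_u + x∘τ_{-u}) =
  2x(x - c)² - (2f'(x)(x - c) - 4f(x))`, `c = x(u)`), `veluLogOp_prod` (Lemma 10 summed);
* `WeierstrassCurve.Affine.Point.veluU_eq_logForm` — for a finite subgroup `G` without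
  `2`-torsion of a short curve over a field (the setting of `VeluOddKernelProofs`):
  `U = (#G·X - Σ'_{v∈G} x(v))·D² - 𝓛(D)`, i.e. Vélu's `x₁ = U/D²` IS `p·x - T₀ - D² log D(x)`
  (Blakestad–Grant's eq. (7); Kohel's formula) — a reading of the tree's `veluU_eq_explicit`
  (`VeluLogDerivativeProofs`) in the `𝓛`-vocabulary used below;
* `X_sq_mul_logDeriv₂Num_clearedEval` — **transport to the formal group**: for `N = ev_d(Q) =
  z^{2d}Q(x(z))` (`clearedEval`), `z²·(N·D²N - (DN)²) = 2d·(zηη' - η²)·N² + ev_{2d+1}(𝓛 Q)`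
  (`D² log N = 2d·D(η/z) + D² log Q(x)`), via the pole-cleared derivation `clearedDeriv` of
  `PadicWeierstrassZetaApproximants` (`𝒟_{2d}(ev_d Q) = -2ev_d(xQ')`, `D(y·g(x)) = L(g)`);
  `clearedEval_logForm`: `ev_p(U)` for `U = (pX - T₀)D² - 𝓛(D)` is the bracket of the hypothesis
  `hV` of `formalXReg_rel_of_velu`;
* **`UniversalOrdinary.mazur_tate_sigma_existsUnique_of_kohel`** — the named fact from: Frobenius
  congruent `A'₄, A'₆`; `T' ≡ tᵖ`, `u ≡ 1 (mod p)` (`R̂`-series); over `K`: a unit `π`, the monic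
  kernel polynomial `D` of degree `n` (`p = 2n+1`), `U = (pX - T₀)D² - 𝓛(D)`, with
  `T' = π·t·ev_n(D)·u`, `ω'(T')dT' = πω`, `X'(T') = ev_p(U)·u²`.

So on Blakestad–Grant's route the named fact now needs exactly: the data of
`VeluKernelReductionProofs` for the canonical subgroup of the universal curve over `R̂`
(with `φ_ψ = p·D`, `T' = t_p/ℓ₀`, `π = p/ℓ₀`, `𝓔' = ⟨0,0,0,ℓ₀⁴A₀,ℓ₀⁶B₀⟩`), the identification of
`x_p(t), ω_p` with the chart of `𝓔'` at `T'` (uniqueness of the formal solution), and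
`veluU_eq_logForm` for `U`.

## Sources

* C. Blakestad, D. Grant, J. Number Theory 249 (2023) 348–376 (arXiv:1903.02480): §2 (`D`,
  `Dx = 2y`), Lemma 10, Lemma 12, Prop. 13 (a) (eq. (7): `D(Dφ_ψ/φ_ψ) = px - x₁ - T'(x)`),
  Thm. 1. [BlakestadGrant2023]
* D. Kohel, *Endomorphism rings of elliptic curves over finite fields*, thesis (Berkeley 1996),
  §2.4 (the `x`-coordinate of the isogeny from the kernel polynomial). [Kohel1996]
* J. Vélu, C. R. Acad. Sci. Paris 273 (1971) 238–241. [Velu1971]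
* B. Mazur, W. Stein, J. Tate, Doc. Math. Extra Vol. Coates (2006), Thm. 1.3. [MazurSteinTate2006]

## Design notes

One definition with body (`veluLogOp`); no named facts; pure proofs. The transport theorem is over
any commutative ring and any `a₁ = a₃ = 0` model (`rhsCubic` keeps `a₂`).
-/

noncomputable section

open Literature.NumberTheory.EllipticCurves
open scoped Polynomial

namespace WeierstrassCurve

/-! ### The second logarithmic `D`-derivative of a polynomial in `x`: `𝓛(Q) = Q²·D² log Q(x)` -/

section LogOp

open Polynomial

variable {R : Type*} [CommRing R] (W : WeierstrassCurve R)

/-- **`𝓛(Q) = 2Q·L(Q') - 4f·Q'²`** (`L(g) = f'g + 2fg'` the tree's `zetaOp`, `f = rhsCubic`): for the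
invariant derivation `D = d/ω` of `y² = f(x)` (`Dx = 2y`, `Dy = f'(x)`) and a polynomial `Q`,
`Q(x)²·D(D(Q(x))/Q(x)) = 2f'Q'Q + 4f(Q''Q - Q'²) = 𝓛(Q)(x)` — the numerator of the second
logarithmic derivative `D(DQ(x)/Q(x))` of Blakestad–Grant's Lemma 10 / Prop. 13
(`D(Dφ_ψ(x)/φ_ψ(x))`). [Blakestad–Grant 2023, Lemma 10, Prop. 13 (a)] [cite: BlakestadGrant2023, Lemma 10] -/
def veluLogOp (Q : R[X]) : R[X] :=
  2 * Q * W.zetaOp (derivative Q) - 4 * W.rhsCubic * derivative Q ^ 2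

/-- `𝓛(Q) = 2f'Q'Q + 4f(Q''Q - Q'²)`. [folklore] -/
theorem veluLogOp_eq (Q : R[X]) : W.veluLogOp Q =
    2 * derivative W.rhsCubic * derivative Q * Q +
      4 * W.rhsCubic * (derivative (derivative Q) * Q - derivative Q ^ 2) := by
  rw [veluLogOp, zetaOp_def]; ring

/-- **`𝓛` is logarithmic**: `𝓛(AB) = 𝓛(A)·B² + A²·𝓛(B)` (`D² log(AB) = D² log A + D² log B`).
[folklore] -/
theorem veluLogOp_mul (A B : R[X]) :
    W.veluLogOp (A * B) = W.veluLogOp A * B ^ 2 + A ^ 2 * W.veluLogOp B := by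
  simp only [veluLogOp_eq, derivative_mul, derivative_add]
  ring

/-- `𝓛(c) = 0`. [folklore] -/
@[simp] theorem veluLogOp_C (c : R) : W.veluLogOp (C c) = 0 := by
  simp [veluLogOp_eq]

/-- `𝓛(1) = 0`. [folklore] -/
@[simp] theorem veluLogOp_one : W.veluLogOp 1 = 0 := by
  rw [← map_one C, veluLogOp_C]

/-- **Blakestad–Grant's Lemma 10 for one root, as polynomials**: `𝓛(X - c) = 2f'·(X - c) - 4f`, i.e.
`D(D(x - x(u))/(x - x(u))) = (2f'(x)(x - x(u)) - 4f(x))/(x - x(u))²` — and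
`2x(x - c)² - (2f'(x)(x - c) - 4f(x)) = 2(x + c)(xc + a₄) + 4a₆ = (x - c)²(τ_u^*x + τ_{-u}^*x)`
(`coeff` identity `two_mul_X_mul_sq_sub_veluLogOp_X_sub_C`), which is their
`D(D(x - x(u))/(x - x(u))) = 2x - (τ_u^*x + τ_{-u}^*x)`. [Blakestad–Grant 2023, Lemma 10]
[cite: BlakestadGrant2023, Lemma 10] -/
theorem veluLogOp_X_sub_C (c : R) :
    W.veluLogOp (X - C c) = 2 * derivative W.rhsCubic * (X - C c) - 4 * W.rhsCubic := by
  simp only [veluLogOp_eq, derivative_sub, derivative_X, derivative_C, sub_zero, derivative_one]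
  ring

/-- The companion identity of Lemma 10 on `y² = x³ + a₂x² + a₄x + a₆`:
`2X(X - c)² - 𝓛(X - c) = 2((3c² + 2a₂c + a₄)X + (-c³ + a₄c + 2a₆))`, i.e. for `a₂ = 0`
`= t_c·X + w_c` with Vélu's `t_c = 6c² + 2a₄`, `w_c = -2c³ + 2a₄c + 4a₆` (`= (x - c)²·(x(P+u) + x(P-u))`
`- 2c(x - c)²` by the chord formula). [Blakestad–Grant 2023, Lemma 10; Vélu 1971] [folklore] -/
theorem two_mul_X_mul_sq_sub_veluLogOp_X_sub_C (c : R) :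
    2 * X * (X - C c) ^ 2 - W.veluLogOp (X - C c) =
      2 * (C (3 * c ^ 2 + 2 * W.a₂ * c + W.a₄) * X + C (-c ^ 3 + W.a₄ * c + 2 * W.a₆)) +
        2 * C c * (X - C c) ^ 2 := by
  rw [veluLogOp_X_sub_C, W.derivative_rhsCubic, rhsCubic_def]
  simp only [map_add, map_mul, map_pow, map_neg, map_ofNat]
  ring

/-- **Lemma 10 summed: `𝓛` of a product of linear factors.**
`𝓛(Π_{c∈s} Q_c) = Σ_{c∈s} 𝓛(Q_c)·Π_{c'≠c} Q_{c'}²`. [Blakestad–Grant 2023, proof of Prop. 13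
("sum the formula in Lemma 10 over the orbits")] [folklore] -/
theorem veluLogOp_prod {ι : Type*} [DecidableEq ι] (s : Finset ι) (Q : ι → R[X]) :
    W.veluLogOp (∏ i ∈ s, Q i) = ∑ i ∈ s, W.veluLogOp (Q i) * ∏ j ∈ s.erase i, Q j ^ 2 := by
  induction s using Finset.induction_on with
  | empty => simp
  | insert a s ha ih =>
    rw [Finset.prod_insert ha, veluLogOp_mul, ih, Finset.sum_insert ha, Finset.erase_insert ha,
      Finset.mul_sum, Finset.prod_pow]
    congr 1
    refine Finset.sum_congr rfl fun i hi => ?_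
    have hia : a ≠ i := fun h => ha (h ▸ hi)
    rw [Finset.erase_insert_of_ne hia, Finset.prod_insert (fun h => ha (Finset.mem_of_mem_erase h))]
    ring

/-- `deg 𝓛(Q) ≤ 2·deg Q + 1`. [folklore] -/
theorem natDegree_veluLogOp_le (Q : R[X]) : (W.veluLogOp Q).natDegree ≤ 2 * Q.natDegree + 1 := by
  by_cases hQ0 : Q.natDegree = 0
  · rw [veluLogOp, derivative_of_natDegree_zero hQ0, zetaOp_zero, mul_zero, zero_pow two_ne_zero,
      mul_zero, sub_zero, natDegree_zero]
    exact Nat.zero_le _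
  have hf := W.natDegree_rhsCubic_le
  have hQ' : (derivative Q).natDegree ≤ Q.natDegree - 1 := natDegree_derivative_le Q
  have hL : (W.zetaOp (derivative Q)).natDegree ≤ Q.natDegree - 1 + 2 :=
    (W.natDegree_zetaOp_le _).trans (by omega)
  rw [veluLogOp]
  refine (natDegree_sub_le _ _).trans (max_le ?_ ?_)
  · rw [mul_assoc, show (2 : R[X]) = C 2 from (map_ofNat C 2).symm]
    refine (natDegree_C_mul_le _ _).trans (natDegree_mul_le.trans ?_)
    omega
  · rw [mul_assoc, show (4 : R[X]) = C 4 from (map_ofNat C 4).symm]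
    refine (natDegree_C_mul_le _ _).trans (natDegree_mul_le.trans ?_)
    have := natDegree_pow_le_of_le 2 hQ'
    omega

/-- `f` commutes with ring maps. [folklore] -/
theorem map_rhsCubic' {S : Type*} [CommRing S] (φ : R →+* S) :
    (W.rhsCubic).map φ = (W.map φ).rhsCubic := by
  simp only [rhsCubic_def, Polynomial.map_add, Polynomial.map_mul, Polynomial.map_pow, map_C, map_X,
    map_a₂, map_a₄, map_a₆]

/-- `𝓛` commutes with ring maps. [folklore] -/
theorem map_veluLogOp {S : Type*} [CommRing S] (φ : R →+* S) (Q : R[X]) :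
    (W.veluLogOp Q).map φ = (W.map φ).veluLogOp (Q.map φ) := by
  simp only [veluLogOp_eq, Polynomial.map_add, Polynomial.map_sub, Polynomial.map_mul, Polynomial.map_pow,
    Polynomial.derivative_map, Polynomial.map_ofNat]
  rw [← map_rhsCubic', Polynomial.derivative_map]

end LogOp

end WeierstrassCurve

namespace WeierstrassCurve

/-! ### Transport to the formal group: `z²·(N D²N - (DN)²) = 2d·(zηη' - η²)N² + ev_{2d+1}(𝓛 Q)` -/

section Transport

open PowerSeries

variable {R : Type*} [CommRing R] (W : WeierstrassCurve R)

/-- Leibniz for the pole-cleared derivation: `𝒟_{M+M'}(FG) = 𝒟_M(F)·G + F·𝒟_{M'}(G)`. [folklore] -/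
theorem clearedDeriv_mul (M M' : ℕ) (F G : R⟦X⟧) :
    W.clearedDeriv (M + M') (F * G) = W.clearedDeriv M F * G + F * W.clearedDeriv M' G := by
  simp only [clearedDeriv_def, Derivation.leibniz, smul_eq_mul, Nat.cast_add]; ring

/-- Changing the level: `𝒟_M(F) - 𝒟_{M'}(F) = (M' - M)·η·F`. [folklore] -/
theorem clearedDeriv_sub_clearedDeriv (M M' : ℕ) (F : R⟦X⟧) :
    W.clearedDeriv M F - W.clearedDeriv M' F = ((M' : R⟦X⟧) - M) * W.formalEta * F := by
  simp only [clearedDeriv_def]; ring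

/-- `𝒟_m(z^m) = 0` (`D(1) = 0`). [folklore] -/
theorem clearedDeriv_X_pow (m : ℕ) : W.clearedDeriv m (X ^ m : R⟦X⟧) = 0 := by
  rcases m with _ | m
  · rw [pow_zero, clearedDeriv_one, Nat.cast_zero, neg_zero, zero_mul]
  · rw [clearedDeriv_def, powerSeries_derivative_pow_succ, PowerSeries.derivative_X, mul_one]
    push_cast
    ring

/-- `z²·(N·D²N - (DN)²) = N·𝒟₁(𝒟₀N) - (𝒟₀N)²` (`zDN = 𝒟₀N`, `z²D(DN) = 𝒟₁(𝒟₀N)`). [folklore] -/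
theorem X_sq_mul_logDeriv₂Num (N : R⟦X⟧) :
    X ^ 2 * logDeriv₂Num W.formalInvariantDerivation N =
      N * W.clearedDeriv 1 (W.clearedDeriv 0 N) - W.clearedDeriv 0 N ^ 2 := by
  simp only [logDeriv₂Num_def, clearedDeriv_def, formalInvariantDerivation_apply, Derivation.leibniz,
    PowerSeries.derivative_X, smul_eq_mul, Nat.cast_zero, Nat.cast_one, zero_mul, sub_zero]
  ring

variable [W.IsCharNeTwoNF]

/-- **`𝒟_{2k}(X^k) = -2k·X^k`** (`D(x^k) = 2k x^{k-1}y`, `z³y = -X`). [folklore] -/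
theorem clearedDeriv_formalXMulSq_pow' (k : ℕ) :
    W.clearedDeriv (2 * k) (W.formalXMulSq ^ k) = -2 * (k : R⟦X⟧) * W.formalXMulSq ^ k := by
  induction k with
  | zero => rw [mul_zero, pow_zero, clearedDeriv_one, Nat.cast_zero]; ring
  | succ k ih =>
    have h2 : W.clearedDeriv 2 W.formalXMulSq = -2 * W.formalXMulSq := by
      rw [clearedDeriv_def]; push_cast; exact W.formalEta_mul_sub_of_isCharNeTwoNF
    rw [show 2 * (k + 1) = 2 * k + 2 by ring, pow_succ, clearedDeriv_mul, ih, h2]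
    push_cast
    ring

/-- **`𝒟_{2d}(ev_d Q) = -2·ev_d(x·Q')`** (`D(Q(x)) = 2y·Q'(x)`, poles cleared). [Blakestad–Grant 2023,
§2 (`Dx = 2y`)] [folklore] -/
theorem clearedDeriv_clearedEval_eq {d : ℕ} {Q : R[X]} (hQ : Q.natDegree ≤ d) :
    W.clearedDeriv (2 * d) (W.clearedEval d Q) =
      -2 * W.clearedEval d (Polynomial.X * Polynomial.derivative Q) := by
  have hsum := Q.as_sum_range' (d + 1) (by omega)
  have hXQ : Polynomial.X * Polynomial.derivative Q =
      ∑ k ∈ Finset.range (d + 1), Polynomial.C (Q.coeff k * k) * Polynomial.X ^ k := by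
    conv_lhs => rw [hsum]
    rw [Polynomial.derivative_sum, Finset.mul_sum]
    refine Finset.sum_congr rfl fun k _ => ?_
    rw [← Polynomial.C_mul_X_pow_eq_monomial, Polynomial.derivative_C_mul_X_pow]
    rcases k with _ | k
    · simp
    · rw [Nat.add_sub_cancel, pow_succ]
      ring
  conv_lhs => rw [hsum]
  rw [hXQ, clearedEval_sum, clearedEval_sum, clearedDeriv_sum, Finset.mul_sum]
  refine Finset.sum_congr rfl fun k hk => ?_
  have hk' : k ≤ d := Nat.lt_succ_iff.mp (Finset.mem_range.mp hk)
  rw [← Polynomial.C_mul_X_pow_eq_monomial, W.clearedEval_C_mul_X_pow hk', W.clearedEval_C_mul_X_pow hk',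
    clearedDeriv_C_mul, show 2 * d = 2 * k + 2 * (d - k) by omega, clearedDeriv_mul,
    clearedDeriv_formalXMulSq_pow', clearedDeriv_X_pow, map_mul, map_natCast]
  ring

/-- **Transport of the second logarithmic derivative**: for `deg Q ≤ d`, `1 ≤ d` and
`N = ev_d(Q) = z^{2d}Q(x)`,
`z²·(N·D²N - (DN)²) = 2d·(zηη' - η²)·N² + ev_{2d+1}(𝓛(Q))` — i.e.
`D² log N = 2d·D(η/z) + D² log Q(x)` with `Q(x)²·D² log Q(x) = 𝓛(Q)(x)` (`Dx = 2y`, `Dy = f'(x)`).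
[Blakestad–Grant 2023, §2 and proof of Prop. 13] [folklore] -/
theorem X_sq_mul_logDeriv₂Num_clearedEval {d : ℕ} (hd : 1 ≤ d) {Q : R[X]} (hQ : Q.natDegree ≤ d) :
    X ^ 2 * logDeriv₂Num W.formalInvariantDerivation (W.clearedEval d Q) =
      2 * (d : R⟦X⟧) * (X * W.formalEta * d⁄dX R W.formalEta - W.formalEta ^ 2) * W.clearedEval d Q ^ 2 +
        W.clearedEval (2 * d + 1) (W.veluLogOp Q) := by
  set N := W.clearedEval d Q with hN
  set E₁ := W.clearedEval d (Polynomial.X * Polynomial.derivative Q) with hE₁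
  set Lq := W.clearedEval (d + 1) (W.zetaOp (Polynomial.derivative Q)) with hLq
  have hQ' : (Polynomial.derivative Q).natDegree ≤ d - 1 :=
    (Polynomial.natDegree_derivative_le Q).trans (Nat.sub_le_sub_right hQ 1)
  -- `P = 𝒟₀N = -2E₁ + 2dηN`
  have hP : W.clearedDeriv 0 N = -2 * E₁ + 2 * (d : R⟦X⟧) * W.formalEta * N := by
    have h1 := W.clearedDeriv_sub_clearedDeriv 0 (2 * d) N
    rw [hN, W.clearedDeriv_clearedEval_eq hQ, ← hN, ← hE₁] at h1
    push_cast at h1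
    linear_combination h1
  -- `𝒟₁E₁ = -ev_{d+1}(LQ') + 2dηE₁`
  have hE : W.clearedDeriv 1 E₁ = -Lq + 2 * (d : R⟦X⟧) * W.formalEta * E₁ := by
    have h1 := W.clearedDeriv_sub_clearedDeriv 1 (2 * d + 1) E₁
    have h2 : W.clearedDeriv (2 * d + 1) E₁ = -Lq := by
      have := W.clearedDeriv_clearedEval hQ'
      rwa [show 2 * (d - 1) + 3 = 2 * d + 1 by omega, show d - 1 + 1 = d by omega,
        show d - 1 + 2 = d + 1 by omega] at this
    push_cast at h1
    linear_combination h1 + h2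
  -- `𝒟₁(ηN) = M·N + η·𝒟₀N`, `M = zηη' - η²`
  have hηN : W.clearedDeriv 1 (W.formalEta * N) =
      W.clearedDeriv 1 W.formalEta * N + W.formalEta * W.clearedDeriv 0 N := by
    have := W.clearedDeriv_mul 1 0 W.formalEta N; rwa [add_zero] at this
  have hM : W.clearedDeriv 1 W.formalEta = X * W.formalEta * d⁄dX R W.formalEta - W.formalEta ^ 2 := by
    rw [clearedDeriv_def]; push_cast; ring
  -- `𝒟₁P`
  have hDP : W.clearedDeriv 1 (W.clearedDeriv 0 N) =
      -2 * W.clearedDeriv 1 E₁ + 2 * (d : R⟦X⟧) * W.clearedDeriv 1 (W.formalEta * N) := by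
    rw [hP, show -2 * E₁ + 2 * (d : R⟦X⟧) * W.formalEta * N =
        PowerSeries.C (-2 : R) * E₁ + PowerSeries.C (2 * d : R) * (W.formalEta * N) by
      simp only [map_neg, map_mul, map_ofNat, map_natCast]; ring,
      clearedDeriv_add, clearedDeriv_C_mul, clearedDeriv_C_mul]
    simp only [map_neg, map_mul, map_ofNat, map_natCast]
  -- `ev_{2d+1}(𝓛 Q) = 2N·ev_{d+1}(LQ') - 4E₁²`
  have hLdeg : (W.zetaOp (Polynomial.derivative Q)).natDegree ≤ d + 1 := (W.natDegree_zetaOp_le _).trans (by omega)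
  have hE₁' : E₁ = W.formalXMulSq * W.clearedEval (d - 1) (Polynomial.derivative Q) := by
    rw [hE₁, ← W.clearedEval_X_mul hQ', show d - 1 + 1 = d by omega]
  have hL : W.clearedEval (2 * d + 1) (W.veluLogOp Q) = 2 * N * Lq - 4 * E₁ ^ 2 := by
    rw [veluLogOp, clearedEval_sub, mul_assoc, show (2 : R[X]) = Polynomial.C 2 from (map_ofNat Polynomial.C 2).symm,
      clearedEval_C_mul, show 2 * d + 1 = d + (d + 1) by ring, W.clearedEval_mul hQ hLdeg, ← hN, ← hLq,
      mul_assoc, show (4 : R[X]) = Polynomial.C 4 from (map_ofNat Polynomial.C 4).symm, clearedEval_C_mul,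
      show d + (d + 1) = 3 + ((d - 1) + (d - 1)) by omega,
      W.clearedEval_mul W.natDegree_rhsCubic_le ((Polynomial.natDegree_pow_le_of_le 2 hQ').trans (by omega)),
      pow_two (Polynomial.derivative Q), W.clearedEval_mul hQ' hQ', clearedEval_rhsCubic_eq_sq, hE₁']
    simp only [map_ofNat]
    ring
  rw [X_sq_mul_logDeriv₂Num, hDP, hE, hηN, hM, hP, hL]
  ring

end Transport

end WeierstrassCurve

namespace WeierstrassCurve

/-! ### The cleared evaluation of `U = (p·X - T₀)·D² - 𝓛(D)` -/

section Kohel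

open PowerSeries

variable {R : Type*} [CommRing R] (W : WeierstrassCurve R)

/-- `ev₁(aX + b) = a·X + b·z²`. [folklore] -/
theorem clearedEval_one_linear (a b : R) :
    W.clearedEval 1 (Polynomial.C a * Polynomial.X + Polynomial.C b) = C a * W.formalXMulSq + C b * X ^ 2 := by
  rw [clearedEval_add, ← pow_one Polynomial.X, W.clearedEval_C_mul_X_pow le_rfl,
    show Polynomial.C b = Polynomial.C b * Polynomial.X ^ 0 by rw [pow_zero, mul_one],
    W.clearedEval_C_mul_X_pow (Nat.zero_le 1)]
  simp

variable [W.IsCharNeTwoNF]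

/-- **`ev_{2n+1}(U)` for `U = ((2n+1)X - T₀)·D² - 𝓛(D)`** (`deg D ≤ n`, `1 ≤ n`, `N = ev_n(D)`):
`ev_{2n+1}(U) = ((2n+1)X - T₀z²)·N² + 2n(zηη' - η²)·N² - z²(N D²N - (DN)²)` — the pole-free form of
`x₁ = p·x - T₀ - D² log D(x)` (Vélu + Blakestad–Grant's Lemma 10, their eq. (7)) on the formal group.
[Blakestad–Grant 2023, Prop. 13 (a), eq. (7); Kohel 1996, §2.4] [cite: BlakestadGrant2023, Prop. 13] -/
theorem clearedEval_logForm {n : ℕ} (hn : 1 ≤ n) {D U : R[X]} (hD : D.natDegree ≤ n) {T₀ : R}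
    (hU : U = (Polynomial.C ((2 * n + 1 : ℕ) : R) * Polynomial.X - Polynomial.C T₀) * D ^ 2 - W.veluLogOp D) :
    W.clearedEval (2 * n + 1) U =
      (((2 * n + 1 : ℕ) : R⟦X⟧) * W.formalXMulSq - C T₀ * X ^ 2) * W.clearedEval n D ^ 2 +
        2 * (n : R⟦X⟧) * (X * W.formalEta * d⁄dX R W.formalEta - W.formalEta ^ 2) * W.clearedEval n D ^ 2 -
        X ^ 2 * logDeriv₂Num W.formalInvariantDerivation (W.clearedEval n D) := by
  have hlin : (Polynomial.C ((2 * n + 1 : ℕ) : R) * Polynomial.X - Polynomial.C T₀).natDegree ≤ 1 := by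
    refine (Polynomial.natDegree_sub_le _ _).trans (max_le ?_ ?_)
    · exact (Polynomial.natDegree_C_mul_le _ _).trans Polynomial.natDegree_X_le
    · rw [Polynomial.natDegree_C]; exact Nat.zero_le _
  have hD2 : (D ^ 2).natDegree ≤ n + n := (Polynomial.natDegree_pow_le_of_le 2 hD).trans (by omega)
  have ht := W.X_sq_mul_logDeriv₂Num_clearedEval hn hD
  have h1 : W.clearedEval 1 (Polynomial.C ((2 * n + 1 : ℕ) : R) * Polynomial.X - Polynomial.C T₀) =
      ((2 * n + 1 : ℕ) : R⟦X⟧) * W.formalXMulSq - C T₀ * X ^ 2 := by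
    rw [sub_eq_add_neg, ← Polynomial.C_neg, clearedEval_one_linear, map_natCast, map_neg]; ring
  have h2 : W.clearedEval (n + n) (D ^ 2) = W.clearedEval n D ^ 2 := by
    rw [pow_two, W.clearedEval_mul hD hD, pow_two]
  have hmul := W.clearedEval_mul hlin hD2
  rw [show 1 + (n + n) = 2 * n + 1 by ring, h1, h2] at hmul
  rw [hU, clearedEval_sub, hmul]
  linear_combination ht

end Kohel

end WeierstrassCurve

/-! ### Link with Vélu's `U` (tree: `veluU_eq_explicit`) -/

namespace WeierstrassCurve.Affine.Point

open Polynomial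
open scoped Classical

variable {K : Type*} [Field K] {W : WeierstrassCurve K} {G : Finset W.toAffine.Point} [W.IsShortNF]

/-- **Vélu's `x`-numerator in logarithmic form: `U = (#G·X - Σ'_{v∈G} x(v))·D² - 𝓛(D)`** (`D` the
kernel polynomial), i.e. `x₁ = U/D² = p·x - Σ' x(v) - D(D D(x)/D(x))` — Blakestad–Grant's eq. (7)
(Vélu summed with Lemma 10), here read off the tree's explicit form `veluU_eq_explicit`
(`U = pXD² - 2f'DD' + 4fD'² - 4fDD'' - T'D²`). [Blakestad–Grant 2023, Lemma 10, Prop. 13 (a) eq. (7);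
Kohel 1996, §2.4] [cite: BlakestadGrant2023, Prop. 13] -/
theorem veluU_eq_logForm (hG : IsOddSubgroupFinset G) (h2 : (2 : K) ≠ 0) :
    veluU G = (C (((G.erase 0).card + 1 : ℕ) : K) * Polynomial.X - C (∑ v ∈ G.erase 0, xOf v)) *
      veluD G ^ 2 - W.veluLogOp (veluD G) := by
  rw [veluU_eq_explicit hG h2, veluLogOp_eq, show W.rhsCubic = veluF W by
    rw [rhsCubic_def, veluF, W.a₂_of_isShortNF, Polynomial.C_0, zero_mul, add_zero]]
  push_cast
  ring

end WeierstrassCurve.Affine.Point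

/-! ### Assembly: the named fact from the kernel polynomial of the canonical `p`-isogeny -/

namespace Literature.NumberTheory.EllipticCurves.UniversalOrdinary

open PowerSeries WeierstrassCurve

/-- **`WeierstrassCurve.mazur_tate_sigma_existsUnique` (Mazur–Stein–Tate 2006, Thm. 1.3) from
Kohel-form data of the canonical `p`-isogeny of the universal ordinary curve.** For every `p ≥ 5`
(`p = 2n + 1`), over `R̂ = completeRing p`, `K = R̂[1/p]`, `𝓔 = universalCurve p`, suppose given
* `A'₄, A'₆ ∈ R̂`, `A'ᵢ ≡ Aᵢᵖ (mod p)` (Blakestad–Grant Prop. 7(b); `α = frobeniusLift`, `𝓔' = α_*𝓔`);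
* `T' ∈ R̂⟦t⟧` with `T' ≡ tᵖ` and `u ∈ 1 + t²R̂⟦t⟧` with `u ≡ 1 (mod p)` (Prop. 7(c), Lemma 12);
* over `K`: a unit `π`, the kernel polynomial `D ∈ K[X]` (monic of degree `n`; `= φ_ψ/p`), a
  polynomial `U` and `T₀ ∈ K` with **`U = (p·X - T₀)·D² - 𝓛(D)`** (Vélu's `x₁ = U/D²` summed with
  Lemma 10: `veluU_eq_logForm`, `T₀ = Σ' x(v)`), such that `T' = π·t·ev_n(D)·u`
  (`= H⁻¹tᵖφ_ψ(x(t))u`, Lemma 12), `ω'(T')dT' = πω` (`ψ^*ω' = (p/H)ω`) and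
  **`X'(T') = ev_p(U)·u²`** (`x'∘ψ = π⁻²U(x)/D(x)²` read in `𝓔'`'s chart: `T'²x'(T') = t²N²u²·U/D²`).
Then the named fact holds — by `clearedEval_logForm` (transport of `D² log D(x)` to the formal
group), `formalXReg_rel_of_velu`, Prop. 13 and Thm. 1 (`PadicSigmaIsogenyCriterionProofs`).
[Blakestad–Grant 2023, Thm. 1, Prop. 7, Lemmas 10–12, Prop. 13; Kohel 1996 §2.4; Vélu 1971;
Mazur–Stein–Tate 2006, Thm. 1.3] [cite: BlakestadGrant2023, Thm. 1] -/
theorem mazur_tate_sigma_existsUnique_of_kohel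
    (H : ∀ (p : ℕ) [Fact p.Prime], 5 ≤ p →
      ∃ (n : ℕ) (_ : 2 * n + 1 = p) (A'₄ A'₆ : completeRing p)
        (h₄ : A'₄ - univA₄ p ^ p ∈ Ideal.span {(p : completeRing p)})
        (h₆ : A'₆ - univA₆ p ^ p ∈ Ideal.span {(p : completeRing p)})
        (T u : PowerSeries (completeRing p)) (D U : (completeRingQ p)[X]) (π T₀ : completeRingQ p),
        IsUnit π ∧
        (∀ k, coeff k T - (if k = p then 1 else 0) ∈ Ideal.span {(p : completeRing p)}) ∧
        constantCoeff u = 1 ∧ coeff 1 u = 0 ∧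
        (∀ k, coeff (k + 1) u ∈ Ideal.span {(p : completeRing p)}) ∧
        D.natDegree = n ∧ D.Monic ∧
        U = (Polynomial.C (p : completeRingQ p) * Polynomial.X - Polynomial.C T₀) * D ^ 2 -
          ((universalCurve p).map (algebraMap (completeRing p) (completeRingQ p))).veluLogOp D ∧
        PowerSeries.map (algebraMap (completeRing p) (completeRingQ p)) T =
          C π * X * ((universalCurve p).map (algebraMap (completeRing p) (completeRingQ p))).clearedEval n D *
            PowerSeries.map (algebraMap (completeRing p) (completeRingQ p)) u ∧
        (((universalCurve p).map (frobeniusLift p A'₄ A'₆ h₄ h₆)).map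
            (algebraMap (completeRing p) (completeRingQ p))).formalInvDiff.subst
            (PowerSeries.map (algebraMap (completeRing p) (completeRingQ p)) T) *
          d⁄dX (completeRingQ p) (PowerSeries.map (algebraMap (completeRing p) (completeRingQ p)) T) =
          C π * ((universalCurve p).map (algebraMap (completeRing p) (completeRingQ p))).formalInvDiff ∧
        (((universalCurve p).map (frobeniusLift p A'₄ A'₆ h₄ h₆)).map
            (algebraMap (completeRing p) (completeRingQ p))).formalXMulSq.subst
            (PowerSeries.map (algebraMap (completeRing p) (completeRingQ p)) T) =
          ((universalCurve p).map (algebraMap (completeRing p) (completeRingQ p))).clearedEval p U *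
            PowerSeries.map (algebraMap (completeRing p) (completeRingQ p)) u ^ 2) :
    WeierstrassCurve.mazur_tate_sigma_existsUnique := by
  refine WeierstrassCurve.mazur_tate_sigma_existsUnique_of_universal_exp_sigmaExpArg_integral'
    fun p _ hp5 β Λ h0 hev hΛ => ?_
  obtain ⟨n, hnp, A'₄, A'₆, h₄, h₆, T, u, D, U, π, T₀, hπ, hT, hu0, hu1, hu, hDn, hDm, hU, hTu, hTω, hX⟩ := H p hp5
  set ι := algebraMap (completeRing p) (completeRingQ p) with hι
  set E := (universalCurve p).map ι with hE
  haveI : E.IsCharNeTwoNF := by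
    refine ⟨?_, ?_⟩ <;> simp [hE, universalCurve]
  have hn : 1 ≤ n := by omega
  have hDle : D.natDegree ≤ n := hDn.le
  -- `N = ev_n(D)` has constant term `1`
  have hN0 : constantCoeff (E.clearedEval n D) = 1 := by
    rw [E.constantCoeff_clearedEval hDle, ← hDn]; exact hDm
  have hu0' : constantCoeff (PowerSeries.map ι u) = 1 := WeierstrassCurve.constantCoeff_map_eq_one _ hu0
  -- transport `U` to the formal group
  have hpc : ((2 * n + 1 : ℕ) : completeRingQ p) = (p : completeRingQ p) := by rw [hnp]
  have hU' : U = (Polynomial.C ((2 * n + 1 : ℕ) : completeRingQ p) * Polynomial.X - Polynomial.C T₀) * D ^ 2 -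
      E.veluLogOp D := by rw [hpc]; exact hU
  have hevU := E.clearedEval_logForm hn hDle hU'
  rw [hnp] at hevU
  have hpX : (p : PowerSeries (completeRingQ p)) = 2 * (n : PowerSeries (completeRingQ p)) + 1 := by
    rw [← hnp]; push_cast; ring
  have hV : (((universalCurve p).map (frobeniusLift p A'₄ A'₆ h₄ h₆)).map ι).formalXMulSq.subst
      (PowerSeries.map ι T) =
      ((p : PowerSeries (completeRingQ p)) * E.formalXMulSq * E.clearedEval n D ^ 2 +
        ((p : PowerSeries (completeRingQ p)) - 1) *
          (X * E.formalEta * d⁄dX (completeRingQ p) E.formalEta - E.formalEta ^ 2) * E.clearedEval n D ^ 2 -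
        X ^ 2 * logDeriv₂Num E.formalInvariantDerivation (E.clearedEval n D) -
        C T₀ * X ^ 2 * E.clearedEval n D ^ 2) * PowerSeries.map ι u ^ 2 := by
    rw [hX, hevU, hpX]
    ring
  have hT0 : constantCoeff T = 0 := by
    apply algebraMap_completeRingQ_injective p hp5
    have h := congrArg constantCoeff hTu
    rw [map_mul, map_mul, map_mul, constantCoeff_X, mul_zero, zero_mul, zero_mul,
      ← coeff_zero_eq_constantCoeff_apply, coeff_map, coeff_zero_eq_constantCoeff_apply] at h
    rw [h, map_zero]
  have hB := WeierstrassCurve.formalXReg_rel_of_velu p hπ hN0 hu0' hTu hTω hV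
  exact coeff_exp_sigmaExpArg_universalCurve_mem' p hp5 h₄ h₆ hT0 hT hu0 hu1 hu hTω hB h0 hev hΛ

end Literature.NumberTheory.EllipticCurves.UniversalOrdinary
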